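import Summits.QuantumFields.YangMills.Theorems.AllWindowsColdBoxBoxHighLineFPOperatorInverseRows
import Summits.QuantumFields.YangMills.Theorems.AllWindowsColdBoxBoxHighLineFPOperatorFloor

/-!
# ℓ¹ ROW sums (the `ℓ^∞ → ℓ^∞` norm) of the inverse Faddeev–Popov operator: `Σ_j |(fpOperator H V)⁻¹ i j| ≤ C·H²` on the `r₀`-ball

Width seat `ym-line-sfw-p2-w2` (prover-ym-line-sfw-p2-w2-g32-0), free hands for planner ym-idea-2 g18's recorded lift **L1** of the blocker B1 of
the next rung U5 (`Cruxes/BoxWindowHighSU2213/U5-BLOCKERS.md` §2: «redo J2 `OrbitMapContraction` / J4 `OrbitMapBulkSurj` in `ℓ^∞` instead of `ℓ²`;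
needed: `‖F_V⁻¹‖_{∞→∞} ≤ C H² …`»).  This file is the `ℓ^∞` companion of w4's ✓`…FPOperatorInverseRows` (ℓ² rows, `C(1+log H)⁴`) and answers the
memo's «cheapest falsifier» by a tree theorem: the `ℓ^∞ → ℓ^∞` norm of the inverse interior Dirichlet Laplacian is `≤ C·H²` with NO logarithm
(✓T-S5.4f-i `dirichletGreenRowSum`, seat w5 g21), hence so is that of `F_V⁻¹` on the whole `r₀`-ball `C·r₀·H² ≤ 1`:

* `OrbitMapSup.interiorGreen_row_abs_le` — `Σ_y |(dirichletMatrix (interiorSites H))⁻¹ x y| ≤ C_G·H²` (✓4f-i transported along w4's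
  ✓`OrbitMapSurj.dirichletMatrix_interior_submatrix_eq_boxLap`);
* `OrbitMapSup.fpOperator_one_inv_row_abs_eq` / `…_le` — the rows of `F(1)⁻¹ = −(Δ_I⁻¹ ⊗ₖ pauliPerm)` (✓`OrbitMapSurj.fpOperator_one_inv`) have the
  ℓ¹ sums of the rows of `Δ_I⁻¹`;
* `OrbitMapSup.abs_fpOperator_sub_mulVec_le` — the **`ℓ^∞` form of 4c-E**: if the cold-box links satisfy `‖W_e − W'_e‖ ≤ δ` and the field of `v`
  has `‖(♭⁻¹v)_x‖ ≤ t` at every interior site, then `|((F(W) − F(W')) v)_p| ≤ 48·δ·t` (✓`abs_divDefectLin_sub_le`, sixteen neighbour terms);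
  `OrbitMapSup.fpOperator_sub_row_abs_le` — hence the ROW sums `Σ_q |(F(W) − F(W'))_{pq}| ≤ 84·δ` (sign vector, `48√3 ≤ 84`: the same constant as the
  ℓ² bound ✓`fpOperator_sub_opBound`);
* ★ **`OrbitMapSup.fpOperator_inv_row_abs_le`** — `∃ C > 0, ∀ H ≥ 1, ∀ r₀ ≥ 0, C·r₀·H² ≤ 1 → ∀ V (links within defect r₀²), IsUnit (det F_V) ∧
  ∀ i, Σ_j |(fpOperator H V)⁻¹ i j| ≤ C·H²` (Neumann: ✓4f-ii `neumannRowInverse` with `A = F(1)`, `G = F(1)⁻¹`, `E = F(V) − F(1)`, `ε = 252 r₀`, `g = C_G H²`);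
  and its vector form `OrbitMapSup.abs_fpOperator_inv_mulVec_le` (`|(F_V⁻¹ w)_i| ≤ C·H²·M` when `|w_j| ≤ M`).

Everything proved; no definitions; Mathlib + tree only; standard axioms.  HONEST LABEL: an elementary glue lemma for the recorded lift L1 of the
NEXT rung U5 (LINE-20 ⟨stmt-QuantumFields-24336⟩, unstaffed, gated by the critic's N2/I23); S5, U5 and the items ⟨24004⟩ ⟨24335⟩ ⟨24336⟩ remain
OPEN; no stub is closed by name; no crux, rung or summit is proved; **the Yang–Mills mass gap is NOT proved by this file; no summit is proved by a line.**
-/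

set_option autoImplicit false

open Matrix Finset
open scoped Kronecker Matrix.Norms.Operator
open Literature.MathematicalPhysics.QuantumFieldTheory.AxialGauge (boxEdges)
open Literature.MathematicalPhysics.QuantumLattice (LGConfig)
open Literature.Probability.LatticeModels (Site dirichletMatrix)
open Summit.QuantumFields.YangMills.Theorems.AllWindowsColdBox.BoxKernel (Box boxLap)

namespace Summit.QuantumFields.YangMills.Theorems.AllWindowsColdBoxBoxHighLine

namespace OrbitMapSup

variable {H : ℕ}

/-! ## 1. ℓ¹ rows of the interior Dirichlet Green's function -/

/-- **ℓ¹ rows of the interior Dirichlet Green's function**: `Σ_y |(dirichletMatrix (interiorSites H))⁻¹ x y| ≤ C·H²` (✓4f-i, transported along the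
coordinate bijection `Box 4 (2H) univ ≃ interiorSites H`). -/
theorem interiorGreen_row_abs_le : ∃ C : ℝ, 0 ≤ C ∧ ∀ H : ℕ, 1 ≤ H → ∀ x : ↥(interiorSites H),
    ∑ y, |(dirichletMatrix (interiorSites H))⁻¹ x y| ≤ C * (H : ℝ) ^ 2 := by
  obtain ⟨C, hrow⟩ := dirichletGreenRowSum
  refine ⟨max C 0, le_max_right _ _, fun H hH x => ?_⟩
  set e := Equiv.ofBijective _ (OrbitMapSurj.coordsEquivInterior_bijective (H := H)) with he
  have hinv : (boxLap (2 * H) Finset.univ)⁻¹ = ((dirichletMatrix (interiorSites H))⁻¹).submatrix e e := by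
    rw [← OrbitMapSurj.dirichletMatrix_interior_submatrix_eq_boxLap, Matrix.inv_submatrix_equiv]
  have h := hrow H hH (e.symm x)
  rw [hinv] at h
  simp only [Matrix.submatrix_apply, Equiv.apply_symm_apply] at h
  rw [e.sum_comp (fun y => |(dirichletMatrix (interiorSites H))⁻¹ x y|)] at h
  exact h.trans (mul_le_mul_of_nonneg_right (le_max_left _ _) (by positivity))

/-! ## 2. ℓ¹ rows of `F(1)⁻¹ = −(Δ_I⁻¹ ⊗ₖ pauliPerm)` -/

/-- Each row of the signed permutation `pauliPerm` has ℓ¹ sum `1`. -/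
theorem pauliPerm_row_abs (b : Fin 3) : ∑ b', |pauliPerm b b'| = 1 := by
  fin_cases b <;> simp [pauliPerm, Fin.sum_univ_three]

/-- **Rows of `F(1)⁻¹` have the ℓ¹ sums of the rows of `Δ_I⁻¹`.** -/
theorem fpOperator_one_inv_row_abs_eq (p : ↥(interiorSites H) × Fin 3) :
    ∑ t, |(fpOperator H 1)⁻¹ p t| = ∑ y, |(dirichletMatrix (interiorSites H))⁻¹ p.1 y| := by
  rw [OrbitMapSurj.fpOperator_one_inv, Fintype.sum_prod_type]
  refine Finset.sum_congr rfl fun y _ => ?_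
  simp only [Matrix.neg_apply, Matrix.kroneckerMap_apply, abs_neg, abs_mul]
  rw [← Finset.mul_sum, pauliPerm_row_abs, mul_one]

/-- **ℓ¹ rows of `F(1)⁻¹` are `O(H²)`.** -/
theorem fpOperator_one_inv_row_abs_le : ∃ C : ℝ, 0 ≤ C ∧ ∀ H : ℕ, 1 ≤ H → ∀ p : ↥(interiorSites H) × Fin 3,
    ∑ t, |(fpOperator H 1)⁻¹ p t| ≤ C * (H : ℝ) ^ 2 := by
  obtain ⟨C, hC, hrow⟩ := interiorGreen_row_abs_le
  exact ⟨C, hC, fun H hH p => by rw [fpOperator_one_inv_row_abs_eq]; exact hrow H hH p.1⟩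

/-! ## 3. The `ℓ^∞` form of the perturbation bound 4c-E -/

/-- The zero-extended field of a coordinate vector whose interior field is pointwise `≤ t` is pointwise `≤ t` everywhere. -/
theorem norm_extPauli_vecToField_le (v : ↥(interiorSites H) × Fin 3 → ℝ) {t : ℝ} (hv : ∀ x, ‖vecToField H v x‖ ≤ t) (ht : 0 ≤ t)
    (z : Site 4) : ‖extPauli H (vecToField H v) z‖ ≤ t := by
  by_cases hz : z ∈ interiorSites H
  · rw [extPauli_of_mem _ hz]; exact hv _
  · rw [extPauli_of_not_mem _ hz, norm_zero]; exact ht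

/-- **The `ℓ^∞` perturbation bound, two configurations**: if every cold-box link satisfies `‖↑(W e) − ↑(W' e)‖ ≤ δ` and the field of `v` satisfies
`‖(♭⁻¹v)_x‖ ≤ t` at every interior site, then `|((fpOperator H W − fpOperator H W') *ᵥ v) p| ≤ 48·δ·t` for every row `p`. -/
theorem abs_fpOperator_sub_mulVec_le (W W' : LGConfig 4 SU2) {δ : ℝ}
    (hU : ∀ e ∈ boxEdges 4 (2 * H + 1), ‖(W e : Matrix (Fin 2) (Fin 2) ℂ) - (W' e : Matrix (Fin 2) (Fin 2) ℂ)‖ ≤ δ)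
    (v : ↥(interiorSites H) × Fin 3 → ℝ) {t : ℝ} (ht : 0 ≤ t) (hv : ∀ x, ‖vecToField H v x‖ ≤ t)
    (p : ↥(interiorSites H) × Fin 3) :
    |((fpOperator H W - fpOperator H W') *ᵥ v) p| ≤ 48 * δ * t := by
  have hδ : 0 ≤ δ := by
    obtain ⟨μ⟩ := (inferInstance : Nonempty (Fin 4))
    exact (norm_nonneg _).trans (hU _ (LandauBall.out_mem_boxEdges p.1.2 μ))
  set a : Site 4 → EuclideanSpace ℝ (Fin 3) := extPauli H (vecToField H v) with ha
  have haz : ∀ z, ‖a z‖ ≤ t := norm_extPauli_vecToField_le v hv ht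
  rw [Matrix.sub_mulVec, Pi.sub_apply, fpOperator_mulVec, fpOperator_mulVec]
  have h1 := abs_divDefectLin_sub_le W W' a p.1.2 hU p.2
  have h2 : ∑ μ : Fin 4, (‖a ((p.1 : Site 4) - Pi.single μ 1)‖ + ‖a ((p.1 : Site 4) + Pi.single μ 1)‖ + 2 * ‖a (p.1 : Site 4)‖) ≤
      ∑ _μ : Fin 4, (4 * t) := by
    refine Finset.sum_le_sum fun μ _ => ?_
    linarith [haz ((p.1 : Site 4) - Pi.single μ 1), haz ((p.1 : Site 4) + Pi.single μ 1), haz (p.1 : Site 4)]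
  simp only [Finset.sum_const, Finset.card_univ, Fintype.card_fin, nsmul_eq_mul, Nat.cast_ofNat] at h2
  calc _ ≤ 3 * δ * ∑ μ : Fin 4, (‖a ((p.1 : Site 4) - Pi.single μ 1)‖ + ‖a ((p.1 : Site 4) + Pi.single μ 1)‖ + 2 * ‖a (p.1 : Site 4)‖) := h1
    _ ≤ 3 * δ * (4 * (4 * t)) := mul_le_mul_of_nonneg_left h2 (by positivity)
    _ = 48 * δ * t := by ring

/-- The interior field of a coordinate vector with entries in `[−1, 1]` has pointwise norm `≤ √3`. -/
theorem norm_vecToField_le_sqrt_three (v : ↥(interiorSites H) × Fin 3 → ℝ) (hv : ∀ j, |v j| ≤ 1) (x : ↥(interiorSites H)) :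
    ‖vecToField H v x‖ ≤ Real.sqrt 3 := by
  rw [EuclideanSpace.norm_eq]
  refine Real.sqrt_le_sqrt ?_
  calc ∑ b : Fin 3, ‖vecToField H v x b‖ ^ 2 ≤ ∑ _b : Fin 3, (1 : ℝ) := Finset.sum_le_sum fun b _ => by
          rw [vecToField_apply, Real.norm_eq_abs, sq_le_one_iff_abs_le_one, abs_abs]; exact hv (x, b)
    _ = 3 := by simp

/-- `48·√3 ≤ 84`. -/
theorem fortyEight_mul_sqrt_three_le : 48 * Real.sqrt 3 ≤ 84 := by
  have h3 : Real.sqrt 3 ≤ 7 / 4 := by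
    rw [Real.sqrt_le_left (by norm_num)]; norm_num
  linarith

/-- **ROW sums of the perturbation**: under `‖↑(W e) − ↑(W' e)‖ ≤ δ` on the cold-box links, `Σ_q |(fpOperator H W − fpOperator H W') p q| ≤ 84·δ`
(the sign vector of the row has interior field of pointwise norm `≤ √3`, and `48√3 ≤ 84`). -/
theorem fpOperator_sub_row_abs_le (W W' : LGConfig 4 SU2) {δ : ℝ}
    (hU : ∀ e ∈ boxEdges 4 (2 * H + 1), ‖(W e : Matrix (Fin 2) (Fin 2) ℂ) - (W' e : Matrix (Fin 2) (Fin 2) ℂ)‖ ≤ δ)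
    (p : ↥(interiorSites H) × Fin 3) :
    ∑ q, |(fpOperator H W - fpOperator H W') p q| ≤ 84 * δ := by
  classical
  have hδ : 0 ≤ δ := by
    obtain ⟨μ⟩ := (inferInstance : Nonempty (Fin 4))
    exact (norm_nonneg _).trans (hU _ (LandauBall.out_mem_boxEdges p.1.2 μ))
  set E := fpOperator H W - fpOperator H W' with hE
  -- the sign vector of the row `p`
  set s : ↥(interiorSites H) × Fin 3 → ℝ := fun q => if 0 ≤ E p q then 1 else -1 with hs
  have hsq : ∀ q, |s q| ≤ 1 := fun q => by
    simp only [hs]; split_ifs <;> simp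
  have hrow : ∑ q, |E p q| = (E *ᵥ s) p := by
    rw [Matrix.mulVec, dotProduct]
    refine Finset.sum_congr rfl fun q _ => ?_
    simp only [hs]
    split_ifs with h
    · rw [mul_one, abs_of_nonneg h]
    · rw [mul_neg, mul_one, abs_of_neg (lt_of_not_ge h)]
  rw [hrow]
  have h := abs_fpOperator_sub_mulVec_le W W' hU s (Real.sqrt_nonneg 3) (norm_vecToField_le_sqrt_three s hsq) p
  calc (E *ᵥ s) p ≤ |(E *ᵥ s) p| := le_abs_self _
    _ ≤ 48 * δ * Real.sqrt 3 := h
    _ = δ * (48 * Real.sqrt 3) := by ring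
    _ ≤ δ * 84 := mul_le_mul_of_nonneg_left fortyEight_mul_sqrt_three_le hδ
    _ = 84 * δ := by ring

/-! ## 4. ℓ¹ rows of `F(V)⁻¹` on the `r₀`-ball (Neumann, 4f-ii) -/

/-- **★ `ℓ^∞ → ℓ^∞` control of the inverse Faddeev–Popov operator on the `r₀`-ball** (the «Needed» item of L1 in `U5-BLOCKERS.md` §2): one constant
`C > 0` such that for `H ≥ 1`, `r₀ ≥ 0`, `C·r₀·H² ≤ 1` and every configuration `V` whose cold-box links have defect `≤ r₀²`, the operator
`fpOperator H V` is invertible and every row of its inverse has ℓ¹ sum `≤ C·H²`.  (Neumann series around `F(1)`: ✓4f-ii `neumannRowInverse` with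
`g = C_G H²` from `fpOperator_one_inv_row_abs_le`, `ε = 84·3r₀` from `fpOperator_sub_row_abs_le` + ✓`norm_coe_sub_one_le_of_linkDefect`.) -/
theorem fpOperator_inv_row_abs_le : ∃ C : ℝ, 0 < C ∧ ∀ H : ℕ, 1 ≤ H → ∀ r₀ : ℝ, 0 ≤ r₀ → C * r₀ * (H : ℝ) ^ 2 ≤ 1 →
    ∀ V : LGConfig 4 SU2, (∀ e ∈ boxEdges 4 (2 * H + 1), linkDefect V e ≤ r₀ ^ 2) →
      IsUnit (fpOperator H V).det ∧ ∀ i : ↥(interiorSites H) × Fin 3, ∑ j, |(fpOperator H V)⁻¹ i j| ≤ C * (H : ℝ) ^ 2 := by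
  classical
  obtain ⟨C, hC, hrow⟩ := fpOperator_one_inv_row_abs_le
  refine ⟨504 * C + 2 * C + 1, by positivity, fun H hH r₀ hr₀ hCr V hV => ?_⟩
  have hH' : (1 : ℝ) ≤ H := by exact_mod_cast hH
  have hH2 : (1 : ℝ) ≤ (H : ℝ) ^ 2 := one_le_pow₀ hH'
  -- the regime: `r₀ ≤ 1` and `(252 r₀)·(C H²) ≤ 1/2`
  have hr₀1 : r₀ ≤ 1 := by
    nlinarith [mul_nonneg (by positivity : (0 : ℝ) ≤ 504 * C + 2 * C) hr₀, mul_nonneg hr₀ (sub_nonneg.2 hH2)]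
  have hεg : 252 * r₀ * (C * (H : ℝ) ^ 2) ≤ 1 / 2 := by
    nlinarith [mul_nonneg (by positivity : (0 : ℝ) ≤ 2 * C + 1) (mul_nonneg hr₀ (zero_le_one.trans hH2))]
  -- Neumann
  have hAG : fpOperator H 1 * (fpOperator H 1)⁻¹ = 1 :=
    Matrix.mul_nonsing_inv _ (isUnit_iff_ne_zero.2 (det_fpOperator_one_ne_zero H))
  have hE : ∀ i, ∑ j, |(fpOperator H V - fpOperator H 1) i j| ≤ 252 * r₀ := fun i => by
    have h := fpOperator_sub_row_abs_le V 1 (fun e he => by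
      simpa using norm_coe_sub_one_le_of_linkDefect V e hr₀ hr₀1 (hV e he)) i
    linarith
  obtain ⟨G', hG', hG'row⟩ := neumannRowInverse (↥(interiorSites H) × Fin 3) (fpOperator H 1) (fpOperator H 1)⁻¹
    (fpOperator H V - fpOperator H 1) (C * (H : ℝ) ^ 2) (252 * r₀) hAG (hrow H hH) hE hεg
  rw [add_sub_cancel] at hG'
  have hunit : IsUnit (fpOperator H V).det := Matrix.isUnit_det_of_right_inverse hG'
  have hinv : (fpOperator H V)⁻¹ = G' := Matrix.inv_eq_right_inv hG'
  refine ⟨hunit, fun i => ?_⟩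
  rw [hinv]
  calc ∑ j, |G' i j| ≤ 2 * (C * (H : ℝ) ^ 2) := hG'row i
    _ ≤ (504 * C + 2 * C + 1) * (H : ℝ) ^ 2 := by nlinarith [mul_nonneg hC (zero_le_one.trans hH2)]

/-- **Vector form**: on the `r₀`-ball, `|(F_V⁻¹ w)_i| ≤ C·H²·M` whenever `|w_j| ≤ M` for all `j` (same constant). -/
theorem abs_fpOperator_inv_mulVec_le : ∃ C : ℝ, 0 < C ∧ ∀ H : ℕ, 1 ≤ H → ∀ r₀ : ℝ, 0 ≤ r₀ → C * r₀ * (H : ℝ) ^ 2 ≤ 1 →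
    ∀ V : LGConfig 4 SU2, (∀ e ∈ boxEdges 4 (2 * H + 1), linkDefect V e ≤ r₀ ^ 2) →
      IsUnit (fpOperator H V).det ∧ ∀ (w : ↥(interiorSites H) × Fin 3 → ℝ) (M : ℝ), (∀ j, |w j| ≤ M) →
        ∀ i, |((fpOperator H V)⁻¹ *ᵥ w) i| ≤ C * (H : ℝ) ^ 2 * M := by
  obtain ⟨C, hC, h⟩ := fpOperator_inv_row_abs_le
  refine ⟨C, hC, fun H hH r₀ hr₀ hCr V hV => ⟨(h H hH r₀ hr₀ hCr V hV).1, fun w M hw i => ?_⟩⟩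
  have hM : 0 ≤ M := (abs_nonneg _).trans (hw i)
  have hrow := (h H hH r₀ hr₀ hCr V hV).2 i
  rw [Matrix.mulVec, dotProduct]
  calc |∑ j, (fpOperator H V)⁻¹ i j * w j| ≤ ∑ j, |(fpOperator H V)⁻¹ i j * w j| := Finset.abs_sum_le_sum_abs _ _
    _ = ∑ j, |(fpOperator H V)⁻¹ i j| * |w j| := by simp_rw [abs_mul]
    _ ≤ ∑ j, |(fpOperator H V)⁻¹ i j| * M := Finset.sum_le_sum fun j _ => mul_le_mul_of_nonneg_left (hw j) (abs_nonneg _)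
    _ = (∑ j, |(fpOperator H V)⁻¹ i j|) * M := by rw [Finset.sum_mul]
    _ ≤ C * (H : ℝ) ^ 2 * M := mul_le_mul_of_nonneg_right hrow hM

end OrbitMapSup

end Summit.QuantumFields.YangMills.Theorems.AllWindowsColdBoxBoxHighLine
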